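import Mathlib
import Summits.CriticalPhenomena.PercolationContinuityZ3.Theorems.PercNearOneGluingNoHeavyQuantTwoArcHairs
import HarnessLib

/-!
# QUANT lane R8, "FAR beyond trees", layer one on hairy cycles — the TWO-SIDED pairs inequality with sure companions (w-form)

builds on p205010 (kernel theorem, internal audit signed; external expert review pending)

Support file (`--supports stmt-CriticalPhenomena-4575`), seat `prim-quant-p1` (gen 17); memo `quant/prim-quant-p1-g17/FOR-LEAD-TWOCHAIN-B.md` §2, §6.
Continues `…QuantTwoArcHairs` (one-sided w-form `FW`, hair weights `h ∈ [0,1]`).  For the distinguished relay at an interior position `i` the companions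
split into a left list `L` (system `(p_L, p_R) = (1 − β_i, 1 − α_i)`, nearest first) and a right list `R` (system `(p_R, p_L)`); the part of
`P(N ≥ 2) − x = Σ_Q w(Q)Φ(Q)` with at most two open companion hairs is the **two-sided w-form**
  `F₂ = Z_R·F_L + Z_L·F_R + gW_L·gW_R + x·Z_L Z_R`   (`F2W`; `gW = Σ_k h_k (c₁ − c_k) ∏_{l≠k}(1 − h_l)` is the `Z`-weighted cross weight of a side:
the mixed pair `{j, k}` has value `(α_j − α_i)(β_k − β_i) = Δ'_j Δ_k`, g16 (γ′)).
* `gW_nonneg`, `p_mul_gW_eq` (`p·gW = Z·P`, `P = σ + E + ℬ`, hairs `< 1`), `gW_cons_sure`, `F2W_comm`, `FW_nonneg_two_sure`;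
* `cross_pays_nearest_sure` — the one genuinely two-sided boundary case: the right side's only sure companion is its NEAREST one and the left side is
  finite; then `Z_L F_R + gW_L gW_R ≥ 0` although `σ_R < 1` is allowed: Lemma C gives `(p_R + A)C_k ≥ A(σ_R − 1)`, the cross term gives
  `(p_R + A)Δ_k·(p_L G') ≥ A p_L P_L ≥ A p_L σ_L` (from `d_k ≥ 0`), and `σ_L + σ_R ≥ 1`;
* `Quant.TwoArc.F2W_nonneg` — **THE TWO-SIDED PAIRS INEQUALITY IN REGIME A WITH SURE COMPANIONS**: `L, R` non-empty, admissible by hair weight,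
  ordered (`A` non-decreasing, `c` non-increasing), `σ_L + σ_R ≥ 1` ⟹ `F₂ ≥ 0`.  Cases: no sure companion (`twoSided_pairs` ×`Z_L Z_R/(1−x)`);
  sure companions on both sides (`Z_L = Z_R = 0 ≤ gW_L gW_R`); two on one side (`F_S = P₂,S ≥ 0`); exactly one, not nearest
  (`sure_coeff_nonneg_of_nearer`); exactly one, nearest (`cross_pays_nearest_sure`).
With the one-sided `FW_nonneg` this completes the pairs-level algebra of TC-MC regime A for a SURE distinguished relay at every position and every
hair-weight configuration of the companions.  NOT here: the bridge `sunLaw(# ≥ 2) − x ≥ F₂` (dictionary + `Φ(Q) ≥ 0` for `|Q| ≥ 3`) and the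
affine reduction in the distinguished relay's hair; the tied-random relay (open).  Pure real algebra; new definitions `gW`, `F2W`; std axioms. [this work]
-/

namespace Summit.CriticalPhenomena.PercolationContinuityZ3.Theorems

namespace Quant

namespace TwoArc

variable (p c₁ : ℝ)

/-- `Z`-weighted cross weight of a side: `gW = Σ_k h_k (c₁ − c_k) ∏_{l ≠ k}(1 − h_l)` (`= Z·Σ u_k Δ_k`; the mixed pair `{j, k}` of the two-sided
system has value `Δ'_j Δ_k`, so the cross term is `gW_L · gW_R`). [this work] -/
def gW : List HComp → ℝ
  | [] => 0 | k :: ks => k.h * (c₁ - k.c) * zW ks + (1 - k.h) * gW ks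

/-- **The two-sided w-form pairs polynomial**: `F₂ = Z_R F_L + Z_L F_R + gW_L gW_R + x Z_L Z_R` (`= Σ_{|Q| ≤ 2} w(Q) Φ(Q)` over the companions of
both sides; left side = system `(p_L, p_R)`, right side = system `(p_R, p_L)`, `x = 1 − p_L p_R`). [this work] -/
noncomputable def F2W (pL pR : ℝ) (L R : List HComp) : ℝ :=
  zW R * FW pL pR L + zW L * FW pR pL R + gW pR L * gW pL R + xv pL pR * zW L * zW R

variable {p c₁}

/-- `gW` recursion. [this work] -/
@[simp] theorem gW_cons (k : HComp) (ks : List HComp) :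
    gW c₁ (k :: ks) = k.h * (c₁ - k.c) * zW ks + (1 - k.h) * gW c₁ ks := rfl
/-- `gW` of the empty list. [this work] -/
@[simp] theorem gW_nil : gW c₁ [] = 0 := rfl

/-- `gW ≥ 0`. [this work] -/
theorem gW_nonneg {ks : List HComp} (h : ∀ k ∈ ks, HComp.Adm p c₁ k) : 0 ≤ gW c₁ ks := by
  induction ks with
  | nil => simp
  | cons k ks ih =>
    have hk := h k (by simp)
    have h1 := ih (fun l hl => h l (by simp [hl]))
    have h2 := zW_nonneg (ks := ks) (fun l hl => h l (by simp [hl]))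
    rw [gW_cons]
    have : 0 ≤ k.h * (c₁ - k.c) * zW ks := mul_nonneg (mul_nonneg hk.h_nonneg (by linarith [hk.c_le])) h2
    nlinarith [hk.h_le]

/-- Conversion for hairs `< 1`: `p · gW = Z · P` with `P = σ + E + ℬ` (per companion `p u (c₁ − c) = u(d + e) = T + u(T − x) + u e`). [this work] -/
theorem p_mul_gW_eq {ks : List HComp} (h : ∀ l ∈ ks, l.h < 1) :
    p * gW c₁ ks = zW ks * (sigS (ks.map (HComp.toComp p)) + eS p c₁ (ks.map (HComp.toComp p)) + bS (ks.map (HComp.toComp p))) := by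
  induction ks with
  | nil => simp
  | cons l ls ih =>
    have hl : 1 - l.h ≠ 0 := by linarith [h l (by simp)]
    have ih' := ih (fun m hm => h m (by simp [hm]))
    simp only [gW_cons, List.map_cons, sigS_cons, eS_cons, bS_cons, zW_cons]
    have hu : (l.toComp p).u = l.h / (1 - l.h) := rfl
    have hT : (l.toComp p).T = l.h * l.rho p := rfl
    have he : (l.toComp p).e = l.A * l.c := rfl
    have key : l.h = (l.toComp p).u * (1 - l.h) := by rw [hu, div_mul_cancel₀ _ hl]
    rw [hT, he]
    simp only [HComp.rho, xv]
    linear_combination (zW ls * (l.h * (1 - (p + l.A) * l.c) - (1 - p * c₁) + l.A * l.c)) * key + (1 - l.h) * ih'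

/-- With a sure companion `k`, `gW ≥ (c₁ − c_k) · Z(rest)` when `k` is the nearest. [this work] -/
theorem gW_cons_sure (k : HComp) (hk1 : k.h = 1) (ls : List HComp) :
    gW c₁ (k :: ls) = (c₁ - k.c) * zW ls := by
  rw [gW_cons, hk1]; ring

/-- Symmetry of the two-sided w-form. [this work] -/
theorem F2W_comm (pL pR : ℝ) (L R : List HComp) : F2W pL pR L R = F2W pR pL R L := by
  simp only [F2W, xv_comm pL pR]; ring

/-- The one-sided w-form with at least two sure companions is `P₂ ≥ 0`. [this work] -/
theorem FW_nonneg_two_sure (hc₁1 : c₁ ≤ 1) {ks : List HComp} (hadm : ∀ k ∈ ks, HComp.Adm p c₁ k)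
    (hc : ks.Pairwise (fun j k => k.c ≤ j.c)) (js ls : List HComp) (k : HComp) (hks : ks = js ++ k :: ls) (hk1 : k.h = 1)
    (h2 : ∃ l ∈ js ++ ls, l.h = 1) : 0 ≤ FW p c₁ ks := by
  have hz : zW ks = 0 := zW_eq_zero (k := k) (by rw [hks]; simp) hk1
  have hp1 : p1W ks = 0 := by rw [hks]; exact p1W_two_sure k hk1 js ls h2
  have := p2W_nonneg hc₁1 hadm hc
  simp only [FW, hz, hp1]; linarith

/-- Key case of the two-sided w-form: the right side has exactly one sure companion and it is the NEAREST one, the left side is finite.  Then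
`Z_L F_R + gW_L gW_R ≥ 0`: Lemma C gives `(p_R + A) C_k ≥ A(σ_R − 1)`, the cross term gives `(p_R + A)Δ_k G' ≥ A p_L G' ≥ A σ_L`, and `σ_L + σ_R ≥ 1`.
[this work] -/
theorem cross_pays_nearest_sure (pL pR : ℝ) (hpL : 0 ≤ pL) (hpL1 : pL ≤ 1) (hpR : 0 ≤ pR) (hpR1 : pR ≤ 1)
    (L : List HComp) (hLne : L ≠ []) (admL : ∀ k ∈ L, HComp.Adm pL pR k) (hfinL : ∀ k ∈ L, k.h < 1)
    (k : HComp) (hk : HComp.Adm pR pL k) (hk1 : k.h = 1) (ls : List HComp) (admls : ∀ l ∈ ls, HComp.Adm pR pL l)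
    (hfinls : ∀ l ∈ ls, l.h < 1) (hA : ∀ l ∈ ls, k.A ≤ l.A) (hσ : 1 ≤ sigW pL L + sigW pR (k :: ls)) :
    0 ≤ zW L * FW pR pL (k :: ls) + gW pR L * gW pL (k :: ls) := by
  -- the right one-sided w-form with the sure nearest companion
  have hF := FW_one_sure (p := pR) (c₁ := pL) k hk1 ls hfinls [] (by simp)
  simp only [List.nil_append, List.map_nil, List.sum_nil, zero_add, zW_nil, one_mul] at hF
  rw [hF, gW_cons_sure k hk1 ls]
  -- data
  have hkd : 0 ≤ (k.toComp pR).d pR pL := hk.d_nonneg hpL1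
  have hkA0 : 0 ≤ k.A := hk.A_nonneg
  have hadm_ls : ∀ l ∈ ls.map (HComp.toComp pR), Comp.Adm pR pL l := by
    intro l hl; obtain ⟨m, hm, rfl⟩ := List.mem_map.mp hl; exact (admls m hm).toComp hpL1 (hfinls m hm)
  have hA_ls : ∀ l ∈ ls.map (HComp.toComp pR), (k.toComp pR).A ≤ l.A := by
    intro l hl; obtain ⟨m, hm, rfl⟩ := List.mem_map.mp hl; exact hA m hm
  have hC := lemmaC (k.toComp pR) hkA0 hkd hpR (ls.map (HComp.toComp pR)) hadm_ls hA_ls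
  have hT : (k.toComp pR).T = (k.toComp pR).rho pR := by
    show k.h * k.rho pR = 1 - (pR + k.A) * k.c; simp [hk1, HComp.rho]
  have he : (k.toComp pR).e = k.A * k.c := rfl
  have hArw : (k.toComp pR).A = k.A := rfl
  rw [hT, he, hArw] at hC
  -- σ_R = ρ_k + σ(ls)
  have hσR : sigW pR (k :: ls) = (k.toComp pR).rho pR + sigS (ls.map (HComp.toComp pR)) := by
    rw [sigS_map, sigW_cons, hk1, one_mul]; rfl
  -- the left cross weight: pL · gW_L = Z_L · P_L ≥ Z_L σ_L
  have hPL := p_mul_gW_eq (p := pL) (c₁ := pR) hfinL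
  have hZL := zW_pos hfinL
  have hZls := zW_pos hfinls
  have admL' : ∀ l ∈ L.map (HComp.toComp pL), Comp.Adm pL pR l := by
    intro l hl; obtain ⟨m, hm, rfl⟩ := List.mem_map.mp hl; exact (admL m hm).toComp hpR1 (hfinL m hm)
  have hEL := eS_nonneg admL'; have hBL := bS_nonneg admL'
  have hGL := gW_nonneg (c₁ := pR) admL
  -- (pR + A) Δ_k ≥ A pL  (⟸ d_k ≥ 0)
  have hΔ : k.A * pL ≤ (pR + k.A) * (pL - k.c) := by
    have : (k.toComp pR).d pR pL = pR * (pL - k.c) - k.A * k.c := rfl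
    rw [this] at hkd; nlinarith
  -- p_R > 0 and p_L > 0 (a finite admissible left companion exists: x < 1)
  obtain ⟨j, hjL⟩ := List.exists_mem_of_ne_nil L hLne
  have hj := admL' (j.toComp pL) (List.mem_map.mpr ⟨j, hjL, rfl⟩)
  have hx1 : xv pL pR < 1 := lt_of_le_of_lt hj.x_le_T (T_lt_one hpL (j.toComp pL) hj)
  have hpR0 : 0 < pR := by
    by_contra h0
    have hpz : pR = 0 := by linarith
    have : xv pL pR = 1 := by simp [xv, hpz]
    linarith
  have hpL0 : 0 < pL := by
    by_contra h0
    have hpz : pL = 0 := by linarith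
    have : xv pL pR = 1 := by simp [xv, hpz]
    linarith
  have hq : 0 < pR + k.A := by linarith
  have hx0 : 0 ≤ xv pL pR := by
    have : pL * pR ≤ pL := by simpa using mul_le_mul_of_nonneg_left hpR1 hpL
    simp only [xv]; linarith
  have hσL0 : 0 ≤ sigS (L.map (HComp.toComp pL)) := (sigS_ge admL' hx0).1
  have hσ' : 1 ≤ sigS (L.map (HComp.toComp pL)) + ((k.toComp pR).rho pR + sigS (ls.map (HComp.toComp pR))) := by
    rw [← hσR, sigS_map]; exact hσ
  -- abbreviations
  set ZL := zW L with hZLdef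
  set Z' := zW ls with hZ'def
  set I := inc pR pL (k.toComp pR) (ls.map (HComp.toComp pR)) with hIdef
  set PL := sigS (L.map (HComp.toComp pL)) + eS pL pR (L.map (HComp.toComp pL)) + bS (L.map (HComp.toComp pL)) with hPLdef
  set ρk := (k.toComp pR).rho pR with hρk
  set σ' := sigS (ls.map (HComp.toComp pR)) with hσ'def
  -- goal: 0 ≤ ZL * (Z' * (I − A c)) + gW_L * ((pL − c) Z');  multiply by pL (pR + A) > 0
  have hPLnn : 0 ≤ PL := by simp only [hPLdef]; linarith
  have h1 : k.A * (ρk + σ' - 1 + (ρk - ρk)) ≤ (pR + k.A) * (I - k.A * k.c) := hC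
  have h2 : k.A * pL * (ZL * PL) ≤ (pR + k.A) * (pL - k.c) * (ZL * PL) :=
    mul_le_mul_of_nonneg_right hΔ (mul_nonneg hZL.le hPLnn)
  have key : 0 ≤ (pL * (pR + k.A)) * (ZL * (Z' * (I - k.A * k.c)) + gW pR L * ((pL - k.c) * Z')) := by
    have e1 : (pL * (pR + k.A)) * (ZL * (Z' * (I - k.A * k.c)) + gW pR L * ((pL - k.c) * Z'))
        = Z' * (pL * ZL * ((pR + k.A) * (I - k.A * k.c)) + ((pR + k.A) * (pL - k.c)) * (pL * gW pR L)) := by ring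
    rw [e1, hPL]
    apply mul_nonneg hZls.le
    have h3 : pL * ZL * (k.A * (ρk + σ' - 1 + (ρk - ρk))) ≤ pL * ZL * ((pR + k.A) * (I - k.A * k.c)) :=
      mul_le_mul_of_nonneg_left h1 (mul_nonneg hpL hZL.le)
    have h4 : 0 ≤ pL * ZL * k.A * (sigS (L.map (HComp.toComp pL)) + (ρk + σ') - 1) :=
      mul_nonneg (mul_nonneg (mul_nonneg hpL hZL.le) hkA0) (by linarith)
    have h5 : 0 ≤ pL * ZL * k.A * (eS pL pR (L.map (HComp.toComp pL)) + bS (L.map (HComp.toComp pL))) :=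
      mul_nonneg (mul_nonneg (mul_nonneg hpL hZL.le) hkA0) (by linarith)
    have e2 : pL * ZL * (k.A * (ρk + σ' - 1 + (ρk - ρk))) + k.A * pL * (ZL * PL)
        = pL * ZL * k.A * (sigS (L.map (HComp.toComp pL)) + (ρk + σ') - 1)
          + pL * ZL * k.A * (eS pL pR (L.map (HComp.toComp pL)) + bS (L.map (HComp.toComp pL))) := by
      simp only [hPLdef]; ring
    nlinarith [h3, h2, h4, h5, e2]
  exact (mul_nonneg_iff_of_pos_left (mul_pos hpL0 hq)).mp key

/-- **THE TWO-SIDED PAIRS INEQUALITY IN REGIME A WITH SURE COMPANIONS (w-form).**  Left companions `L` (system `(p_L, p_R)`), right companions `R`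
(system `(p_R, p_L)`), both non-empty, admissible by hair weight (`h ∈ [0,1]`), `A` non-decreasing and `c` non-increasing along each list, and
`σ_L + σ_R ≥ 1`.  Then `F₂ = Z_R F_L + Z_L F_R + gW_L gW_R + x Z_L Z_R ≥ 0`.  Cases: no sure companion (`twoSided_pairs`); a side with two sure ones
(`F_S = P₂,S ≥ 0`); one sure on each side (`Z_L = Z_R = 0 ≤ gW_L gW_R`); exactly one sure companion, on one side, the other side finite — not nearest:
`sure_coeff_nonneg_of_nearer`; nearest: `cross_pays_nearest_sure`. [this work] -/
theorem F2W_nonneg (pL pR : ℝ) (hpL : 0 ≤ pL) (hpL1 : pL ≤ 1) (hpR : 0 ≤ pR) (hpR1 : pR ≤ 1)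
    (L R : List HComp) (hLne : L ≠ []) (hRne : R ≠ [])
    (admL : ∀ k ∈ L, HComp.Adm pL pR k) (admR : ∀ k ∈ R, HComp.Adm pR pL k)
    (hAL : L.Pairwise (fun j k => j.A ≤ k.A)) (hcL : L.Pairwise (fun j k => k.c ≤ j.c))
    (hAR : R.Pairwise (fun j k => j.A ≤ k.A)) (hcR : R.Pairwise (fun j k => k.c ≤ j.c))
    (hσ : 1 ≤ sigW pL L + sigW pR R) : 0 ≤ F2W pL pR L R := by
  -- reduce to: "R has no sure companion, or the statement holds"; by symmetry we may treat the side structure case by case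
  have hxc := xv_comm pL pR
  have hZL := zW_nonneg admL; have hZR := zW_nonneg admR
  have hGL := gW_nonneg (c₁ := pR) admL; have hGR := gW_nonneg (c₁ := pL) admR
  have hx0 : 0 ≤ xv pL pR := by simp only [xv]; nlinarith
  -- generic facts used in several cases
  have two_sure : ∀ {q c : ℝ} {S : List HComp}, c ≤ 1 → (∀ k ∈ S, HComp.Adm q c k) → S.Pairwise (fun j k => k.c ≤ j.c) →
      ∀ js ls k, S = js ++ k :: ls → k.h = 1 → (∃ l ∈ js ++ ls, l.h = 1) → 0 ≤ FW q c S ∧ zW S = 0 :=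
    fun hc1 adm hc js ls k hS hk1 h2 => ⟨FW_nonneg_two_sure hc1 adm hc js ls k hS hk1 h2, zW_eq_zero (k := k) (by rw [hS]; simp) hk1⟩
  by_cases hSR : ∃ k ∈ R, k.h = 1 <;> by_cases hSL : ∃ k ∈ L, k.h = 1
  · -- sure companions on both sides: Z_L = Z_R = 0
    obtain ⟨k, hk, hk1⟩ := hSR; obtain ⟨j, hj, hj1⟩ := hSL
    simp only [F2W, zW_eq_zero hk hk1, zW_eq_zero hj hj1, zero_mul, mul_zero, zero_add, add_zero]
    exact mul_nonneg hGL hGR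
  · -- sure on the right only
    have hfinL : ∀ k ∈ L, k.h < 1 := fun k hk => lt_of_le_of_ne (admL k hk).h_le (fun h1 => hSL ⟨k, hk, h1⟩)
    obtain ⟨k, hkmem, hk1⟩ := hSR
    obtain ⟨js, ls, hR⟩ := List.append_of_mem hkmem
    have hzR : zW R = 0 := zW_eq_zero hkmem hk1
    by_cases h2 : ∃ l ∈ js ++ ls, l.h = 1
    · have hF := (two_sure hpL1 admR hcR js ls k hR hk1 h2).1
      simp only [F2W, hzR, zero_mul, mul_zero, zero_add, add_zero]
      exact add_nonneg (mul_nonneg hZL hF) (mul_nonneg hGL hGR)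
    have hjs : ∀ m ∈ js, m.h < 1 := fun m hm => lt_of_le_of_ne (admR m (by rw [hR]; simp [hm])).h_le (fun h1 => h2 ⟨m, by simp [hm], h1⟩)
    have hls : ∀ m ∈ ls, m.h < 1 := fun m hm => lt_of_le_of_ne (admR m (by rw [hR]; simp [hm])).h_le (fun h1 => h2 ⟨m, by simp [hm], h1⟩)
    have hk := admR k hkmem
    rw [hR] at hAR hcR admR
    rcases List.pairwise_append.mp hAR with ⟨_, hAkls, _⟩
    rcases List.pairwise_cons.mp hAkls with ⟨hAk, _⟩
    rcases List.pairwise_append.mp hcR with ⟨_, hckls, hccross⟩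
    rcases List.pairwise_cons.mp hckls with ⟨hck, _⟩
    cases js with
    | cons j js' =>
      -- not the nearest: F_R ≥ 0 outright
      have hF : 0 ≤ FW pR pL R := by
        rw [hR, FW_one_sure k hk1 ls hls (j :: js') hjs]
        exact mul_nonneg (mul_nonneg (zW_pos hjs).le (zW_pos hls).le)
          (sure_coeff_nonneg_of_nearer hpR1 hpL1 k hk (j :: js') ls hjs hls (by simp)
            (fun m hm => admR m (by
              rcases List.mem_append.mp hm with h | h
              exacts [List.mem_append.mpr (Or.inl h), List.mem_append.mpr (Or.inr (List.mem_cons_of_mem _ h))]))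
            (fun j' hj' => hccross j' hj' k (by simp)) hck)
      simp only [F2W, hzR, zero_mul, mul_zero, zero_add, add_zero]
      exact add_nonneg (mul_nonneg hZL hF) (mul_nonneg hGL hGR)
    | nil =>
      simp only [List.nil_append] at hR
      simp only [F2W, hzR, zero_mul, mul_zero, zero_add, add_zero]
      rw [hR]
      rw [hR] at hσ
      exact cross_pays_nearest_sure pL pR hpL hpL1 hpR hpR1 L hLne admL hfinL k hk hk1 ls
        (fun l hl => admR l (by simp [hl])) hls hAk hσ
  · -- sure on the left only: symmetry
    rw [F2W_comm]
    have hfinR : ∀ k ∈ R, k.h < 1 := fun k hk => lt_of_le_of_ne (admR k hk).h_le (fun h1 => hSR ⟨k, hk, h1⟩)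
    obtain ⟨k, hkmem, hk1⟩ := hSL
    obtain ⟨js, ls, hL⟩ := List.append_of_mem hkmem
    have hzL : zW L = 0 := zW_eq_zero hkmem hk1
    have hσ' : 1 ≤ sigW pR R + sigW pL L := by linarith
    by_cases h2 : ∃ l ∈ js ++ ls, l.h = 1
    · have hF := (two_sure hpR1 admL hcL js ls k hL hk1 h2).1
      simp only [F2W, hzL, zero_mul, mul_zero, zero_add, add_zero]
      exact add_nonneg (mul_nonneg hZR hF) (mul_nonneg hGR hGL)
    have hjs : ∀ m ∈ js, m.h < 1 := fun m hm => lt_of_le_of_ne (admL m (by rw [hL]; simp [hm])).h_le (fun h1 => h2 ⟨m, by simp [hm], h1⟩)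
    have hls : ∀ m ∈ ls, m.h < 1 := fun m hm => lt_of_le_of_ne (admL m (by rw [hL]; simp [hm])).h_le (fun h1 => h2 ⟨m, by simp [hm], h1⟩)
    have hk := admL k hkmem
    rw [hL] at hAL hcL admL
    rcases List.pairwise_append.mp hAL with ⟨_, hAkls, _⟩
    rcases List.pairwise_cons.mp hAkls with ⟨hAk, _⟩
    rcases List.pairwise_append.mp hcL with ⟨_, hckls, hccross⟩
    rcases List.pairwise_cons.mp hckls with ⟨hck, _⟩
    cases js with
    | cons j js' =>
      have hF : 0 ≤ FW pL pR L := by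
        rw [hL, FW_one_sure k hk1 ls hls (j :: js') hjs]
        exact mul_nonneg (mul_nonneg (zW_pos hjs).le (zW_pos hls).le)
          (sure_coeff_nonneg_of_nearer hpL1 hpR1 k hk (j :: js') ls hjs hls (by simp)
            (fun m hm => admL m (by
              rcases List.mem_append.mp hm with h | h
              exacts [List.mem_append.mpr (Or.inl h), List.mem_append.mpr (Or.inr (List.mem_cons_of_mem _ h))]))
            (fun j' hj' => hccross j' hj' k (by simp)) hck)
      simp only [F2W, hzL, zero_mul, mul_zero, zero_add, add_zero]
      exact add_nonneg (mul_nonneg hZR hF) (mul_nonneg hGR hGL)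
    | nil =>
      simp only [List.nil_append] at hL
      simp only [F2W, hzL, zero_mul, mul_zero, zero_add, add_zero]
      rw [hL]
      rw [hL] at hσ'
      exact cross_pays_nearest_sure pR pL hpR hpR1 hpL hpL1 R hRne admR hfinR k hk hk1 ls
        (fun l hl => admL l (by simp [hl])) hls hAk hσ'
  · -- no sure companion at all: the u-form theorem
    have hfinL : ∀ k ∈ L, k.h < 1 := fun k hk => lt_of_le_of_ne (admL k hk).h_le (fun h1 => hSL ⟨k, hk, h1⟩)
    have hfinR : ∀ k ∈ R, k.h < 1 := fun k hk => lt_of_le_of_ne (admR k hk).h_le (fun h1 => hSR ⟨k, hk, h1⟩)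
    have admL' : ∀ l ∈ L.map (HComp.toComp pL), Comp.Adm pL pR l := by
      intro l hl; obtain ⟨m, hm, rfl⟩ := List.mem_map.mp hl; exact (admL m hm).toComp hpR1 (hfinL m hm)
    have admR' : ∀ l ∈ R.map (HComp.toComp pR), Comp.Adm pR pL l := by
      intro l hl; obtain ⟨m, hm, rfl⟩ := List.mem_map.mp hl; exact (admR m hm).toComp hpL1 (hfinR m hm)
    have hT := twoSided_pairs pL pR hpL hpL1 hpR hpR1 (L.map (HComp.toComp pL)) (R.map (HComp.toComp pR))
      (by simpa using hLne) (by simpa using hRne) admL' admR'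
      (List.pairwise_map.mpr (hAL.imp (by intro a b h; exact h))) (List.pairwise_map.mpr (hcL.imp (by intro a b h; exact h)))
      (List.pairwise_map.mpr (hAR.imp (by intro a b h; exact h))) (List.pairwise_map.mpr (hcR.imp (by intro a b h; exact h)))
      (by rw [sigS_map, sigS_map]; exact hσ)
    have hFL := FW_eq (p := pL) (c₁ := pR) hfinL
    have hFR := FW_eq (p := pR) (c₁ := pL) hfinR
    have hGL' := p_mul_gW_eq (p := pL) (c₁ := pR) hfinL
    have hGR' := p_mul_gW_eq (p := pR) (c₁ := pL) hfinR
    have hZLp := zW_pos hfinL; have hZRp := zW_pos hfinR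
    -- x < 1 (a finite admissible companion exists), and p_L p_R = 1 − x
    obtain ⟨j, L', rfl⟩ := List.exists_cons_of_ne_nil hLne
    have hj := admL' (j.toComp pL) (by simp)
    have hx1 : xv pL pR < 1 := lt_of_le_of_lt hj.x_le_T (T_lt_one hpL (j.toComp pL) hj)
    have hpp : pL * pR = 1 - xv pL pR := by simp [xv]
    -- (1 − x) · F₂ = Z_L Z_R · [(1−x)(Ω_L + Ω_R − x) + P_L P_R] ≥ 0
    rw [← hxc] at hFR
    have key : (1 - xv pL pR) * F2W pL pR (j :: L') R
        = zW (j :: L') * zW R * ((1 - xv pL pR) * ((piS pL pR ((j :: L').map (HComp.toComp pL)) - bS ((j :: L').map (HComp.toComp pL)))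
          + (piS pR pL (R.map (HComp.toComp pR)) - bS (R.map (HComp.toComp pR))) - xv pL pR)
          + (sigS ((j :: L').map (HComp.toComp pL)) + eS pL pR ((j :: L').map (HComp.toComp pL)) + bS ((j :: L').map (HComp.toComp pL)))
            * (sigS (R.map (HComp.toComp pR)) + eS pR pL (R.map (HComp.toComp pR)) + bS (R.map (HComp.toComp pR)))) := by
      simp only [F2W]
      linear_combination ((1 - xv pL pR) * zW R) * hFL + ((1 - xv pL pR) * zW (j :: L')) * hFR
        + (pR * gW pL R) * hGL' + (zW (j :: L') * (sigS ((j :: L').map (HComp.toComp pL))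
          + eS pL pR ((j :: L').map (HComp.toComp pL)) + bS ((j :: L').map (HComp.toComp pL)))) * hGR'
        - (gW pR (j :: L') * gW pL R) * hpp
    have : 0 ≤ (1 - xv pL pR) * F2W pL pR (j :: L') R := by
      rw [key]; exact mul_nonneg (mul_nonneg hZLp.le hZRp.le) hT
    exact (mul_nonneg_iff_of_pos_left (by linarith)).mp this

end TwoArc

end Quant

end Summit.CriticalPhenomena.PercolationContinuityZ3.Theorems
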